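import Summits.BirchSwinnertonDyer.Rank1Residual.X11b.BDPRouteRigidity
import Summits.BirchSwinnertonDyer.Rank1Residual.O5.HeegnerTwistTamagawaThree
import Summits.BirchSwinnertonDyer.Rank1Residual.X11b.Three.StepLAtThree
import HarnessLib

/-!
# Route `KolyvaginRoadThree`, deciding crux `ZhangSharpFrameAtThreeHL` (item stmt-BirchSwinnertonDyer-19574): the
# bookkeeping it needs at ANY Heegner field (part 1 of 2): STEP L ⟺ `BSD(E,3)` at a Heegner datum with `d_K` odd OR
# EVEN, the tree's `_of_odd` theorems with `Odd d_K` DELETED (Barrios et al. 2025 at `2`, discharged)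
# (cell `bsd-stepL`, seat `bsd-stepL-zhang3-p1` g3; `--supports stmt-BirchSwinnertonDyer-19574`, helper)

THEOREMS ONLY (no definition, no named fact, no `sorry`); nothing about Kolyvagin's conjecture at `p = 3` and nothing
about `BSD(E,3)` is asserted (`BSDp W 3` ∕ the class are HYPOTHESES); published inputs are named facts of the tree
taken as binders. PARTITION: O2@3 (B10) × A1 (1 116 TRUE-OPEN classes; cw 248 943) — types-the-object-of; closes: none.

THE POINT. `KolyvaginRoadThreeCruxIffLeaf.lean` (p431973) proved `BSDp W 3 ⟹ c₁(n) ≠ 0` at Hoffstein–Luo frames with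
`d_K` ODD, because the tree's STEP-L-from-`BSD(E,p)` bookkeeping at `p = 3` (`BDPRouteOddPrime`∕`BDPRouteRigidity`,
eisenstein-p2's transport `X2.padicValNat_tamagawaProduct_twist_of_heegner_of_odd`) asked `d_K` odd: at an even `d_K`
the twist `E^{(d_K)}` is additive at `2` and `c₂(E^{(d_K)}) = 3` had to be excluded. That exclusion IS a tree
theorem now: Barrios–Roy–Sahajpal–Tallana–Tobin–Wiersema 2025 Thm. 5.1 is vendored AND DISCHARGED
(`c₂ ∈ {1,2,4}` for twists of curves good at `2`), cashed by harvest-2 as the ANY-`d_K` transport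
`O5.TwistTamagawa.padicValNat_tamagawaProduct_twist_of_heegner_three`. With it the whole `p = 3` bookkeeping runs
for every Heegner field (`3 ∤ d_K` and `3 ∤ #𝓞_K^×` from the Heegner hypothesis at `3 ∣ N`; `d_K < −4` from the
frame's orientation), and:

* `X11b.indexLowerBoundAt_of_bsdp_of_heegnerData_three` ∕ `X11b.bsdp_of_indexLowerBoundAt_of_heegnerData_three` —
  STEP L ⟺ `BSD(E,3)` at ANY Heegner datum with `L(E^{d_K},1) ≠ 0` of an X11b@3 ∧ (ram) curve, `3 ∤ ∏c` for ⟸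
  (the `_of_odd` theorems of `BDPRouteRigidity` with `Odd d_K` DELETED);
* part 2 (`KolyvaginRoadThreeCruxIffLeafAnyDiscr.lean`) draws the consequences for the crux: the converse and the
  end-to-end theorem at ANY Heegner frame with `L(E^{d_K},1) ≠ 0`, and `zhangFrameL_iff_bsdp_onA1` (the parent 19153
  exceeds the leaf EXACTLY on the `L(E^{d_K},1) = 0` frames; the item's `Odd d_K` binder is harmless).

References (locators only): [cite: BarriosEtAl2025, Thm. 5.1 and §5 tables rows I₀] [cite: WZhang2014, Remark 5, Thm. 10.2]
[cite: McCallumLMS1991, §4 Cor. 4.5, §5 Lemma 5.1 and Cor. 5.6] [cite: GrossLMS1991, §3, §4 (4.1)]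
[cite: JetchevSkinnerWan2017, §7.4.1–7.4.3 and (eq:tamK)] [cite: Skinner2016PacificMC, Thm. C].
-/

noncomputable section

open scoped Classical

/-! ## §1 STEP L ⟺ `BSD(E,3)` at ANY Heegner datum (the `_of_odd` bookkeeping with `Odd d_K` deleted) -/

namespace Summit.BirchSwinnertonDyer.Rank1Residual.X11b

open WeierstrassCurve NumberField Literature.NumberTheory.EllipticCurves
  Literature.NumberTheory.EllipticCurves.ModularForms
  Literature.NumberTheory.EllipticCurves.Rank1Residual
  Summit.BirchSwinnertonDyer.Rank1Residual

/-- **STEP L at the datum from `BSD(E,3)` — ANY Heegner field** (`indexLowerBoundAt_of_bsdp_of_heegnerData_of_odd` at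
`p = 3` with `Odd d_K` DELETED): data `W/ℚ` globally minimal with `(E,3) ∈ X11b` and a (ram) witness; `K` imaginary
quadratic Heegner for `N_E` (any parity of `d_K`) with `L(E^{d_K},1) ≠ 0`; the Heegner point `P` of a datum
`(Dt, H, ι)` with `3 ∤ c(Dt)`; a globally minimal model `Wd = Cd • E^{(d_K)}`. PUBLISHED binders `hGZ hKo hSk hGZK
hmod`. The Tamagawa transport at `3` for any `d_K` is harvest-2's `padicValNat_tamagawaProduct_twist_of_heegner_three`
(Barrios et al. 2025 discharged at `2`); `3 ∤ d_K`, `3 ∤ #𝓞_K^×` from the Heegner hypothesis at `3 ∣ N`.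
[cite: BarriosEtAl2025, Thm. 5.1] [cite: JetchevSkinnerWan2017, §7.4.1 and (eq:tamK)] [cite: Skinner2016PacificMC, Thm. C] -/
theorem indexLowerBoundAt_of_bsdp_of_heegnerData_three
    (W : WeierstrassCurve ℚ) [W.IsElliptic] [W.IsGloballyMinimal] [NeZero (W.conductorNorm ℤ)]
    (K : Type) [Field K] [NumberField K]
    (Dt : ModularParametrizationData W (W.conductorNorm ℤ))
    (H : HeegnerDatum (W.conductorNorm ℤ) (NumberField.discr K)) (ι : K →+* ℂ)
    (P : (W.baseChange K).toAffine.Point)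
    (hGZ : gross_zagier (W.conductorNorm ℤ) W K) (hKo : kolyvagin (W.conductorNorm ℤ) W K)
    (hSk : Skinner2016.thmC_padicValRat_bsd_rank_zero)
    (hGZK : rank_eq_analyticRank_of_analyticRank_le_one) (hmod : hasEntireLFunction_rat)
    (hX : ClassX11b W 3) (hram : Ram W 3)
    (hK : IsImaginaryQuadratic K) (hHN : SatisfiesHeegnerHypothesis (W.conductorNorm ℤ) K)
    (hP : WeierstrassCurve.Affine.Point.map ι.toRatAlgHom P = heegnerPointComplex Dt H)
    (hc : ¬ (3 : ℤ) ∣ Dt.c)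
    (hLt : (W.quadraticTwist (NumberField.discr K : ℚ)).entireLFunction 1 ≠ 0)
    (Wd : WeierstrassCurve ℚ) [Wd.IsElliptic] [Wd.IsGloballyMinimal] (Cd : VariableChange ℚ)
    (hWd : Cd • W.quadraticTwist (NumberField.discr K : ℚ) = Wd)
    (hbsd : BSDp W 3) : IndexLowerBoundAt W 3 K P := by
  haveI : Fact (Nat.Prime 3) := ⟨Nat.prime_three⟩
  have hr : W.analyticRank = 1 := hX.1
  have hmult : W.HasMultiplicativeReductionAtPrime 3 := hX.2.2.1
  have hirr : Irr W 3 := hX.2.2.2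
  obtain ⟨h3d, hμ⟩ := Three.not_dvd_discr_and_not_dvd_torsionOrder_of_heegner hK hHN (p := 3) (by decide)
    (Three.dvd_conductorNorm_of_classX11b hX)
  have hD0 : (NumberField.discr K : ℚ) ≠ 0 := by exact_mod_cast NumberField.discr_ne_zero K
  haveI hEt : (W.quadraticTwist (NumberField.discr K : ℚ)).IsElliptic := W.isElliptic_quadraticTwist hD0
  -- transports to the minimal twist model (any parity of `d_K` at `3`)
  have hmultd : Wd.HasMultiplicativeReductionAtPrime 3 :=
    hasMultiplicativeReductionAtPrime_twist_of_heegner' W 3 K hK hHN hmult Cd hWd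
  have hirrd : Wd.HasIrreducibleModPGaloisRep 3 := hasIrreducibleModPGaloisRep_twist_model W 3 K hK.1 hirr Cd hWd
  have hramd : Ram Wd 3 := ram_twist_of_heegner W 3 K hK hHN hram Cd hWd
  have htam : padicValNat 3 Wd.tamagawaProduct = padicValNat 3 W.tamagawaProduct :=
    O5.TwistTamagawa.padicValNat_tamagawaProduct_twist_of_heegner_three W Wd K hK hHN h3d Cd hWd
  have hu : padicValRat 3 (Cd.u : ℚ) = 0 := padicValRat_u_eq_zero_of_twist_minimal W 3 K hK hHN hmult Cd hWd
  -- Skinner's Thm. C for the twist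
  have hLt' : (W.quadraticTwist (NumberField.discr K : ℚ)).entireLFunction = Wd.entireLFunction := by
    rw [← hWd, entireLFunction_smul]
  have hLd1 : Wd.entireLFunction 1 ≠ 0 := by rw [← hLt']; exact hLt
  have hrd : Wd.analyticRank = 0 := (Wd.analyticRank_eq_zero_iff_holds (hmod Wd)).2 hLd1
  have hfinSd : Finite Wd.sha := (hGZK Wd (by omega)).2
  obtain ⟨qd, hqd, hvqd⟩ := hSk Wd 3 le_rfl (Or.inr hmultd) hirrd hramd hLd1 hfinSd
  -- the lower half of `BSD(E,3)`, then the index-currency transport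
  haveI : Finite W.sha := (hGZK W (le_of_eq hr)).2
  have hlow : Typed.MissingLowerBoundAt W 3 :=
    (Typed.lower_and_upper_of_missingPPartAt W 3 (Typed.missingPPartAt_of_bsdp W 3 hbsd)).1
  exact indexLowerBoundAt_of_missingLowerBoundAt W 3 (W.conductorNorm ℤ) K Dt H ι P hGZ hKo hGZK hmod hK hHN hP
    (by decide) (by exact_mod_cast hc) hμ hr hLt Wd Cd hWd hu htam ⟨qd, hqd, hvqd.le⟩ hlow

/-- **`BSD(E,3)` from STEP L at ONE Heegner datum — ANY Heegner field, on A1** (`bsdp_of_indexLowerBoundAt_of_heegnerData_of_odd`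
at `p = 3` with `Odd d_K` DELETED): same data as above plus `3 ∤ ∏_ℓ c_ℓ(E)` and Kolyvagin's bound `hB`; STEP L at the
datum (`hL`) gives `BSDp W 3` (lower half from STEP L, upper half from Kolyvagin's bound; `X11b.bsdp_of_halves`).
[cite: BarriosEtAl2025, Thm. 5.1] [cite: JetchevSkinnerWan2017, §7.4.1–7.4.2 and (eq:tamK)]
[cite: McCallumLMS1991, §1 Theorem (Kolyvagin)] [cite: Skinner2016PacificMC, Thm. C] -/
theorem bsdp_of_indexLowerBoundAt_of_heegnerData_three
    (W : WeierstrassCurve ℚ) [W.IsElliptic] [W.IsGloballyMinimal] [NeZero (W.conductorNorm ℤ)]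
    (K : Type) [Field K] [NumberField K]
    (Dt : ModularParametrizationData W (W.conductorNorm ℤ))
    (H : HeegnerDatum (W.conductorNorm ℤ) (NumberField.discr K)) (ι : K →+* ℂ)
    (P : (W.baseChange K).toAffine.Point)
    (hGZ : gross_zagier (W.conductorNorm ℤ) W K) (hKo : kolyvagin (W.conductorNorm ℤ) W K)
    (hB : Kolyvagin1990_padicValNat_card_sha_le (W.conductorNorm ℤ) W K)
    (hSk : Skinner2016.thmC_padicValRat_bsd_rank_zero)
    (hGZK : rank_eq_analyticRank_of_analyticRank_le_one) (hmod : hasEntireLFunction_rat)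
    (hX : ClassX11b W 3) (hram : Ram W 3) (htam0 : ¬ 3 ∣ W.tamagawaProduct)
    (hK : IsImaginaryQuadratic K) (hHN : SatisfiesHeegnerHypothesis (W.conductorNorm ℤ) K)
    (hP : WeierstrassCurve.Affine.Point.map ι.toRatAlgHom P = heegnerPointComplex Dt H)
    (hc : ¬ (3 : ℤ) ∣ Dt.c)
    (hLt : (W.quadraticTwist (NumberField.discr K : ℚ)).entireLFunction 1 ≠ 0)
    (Wd : WeierstrassCurve ℚ) [Wd.IsElliptic] [Wd.IsGloballyMinimal] (Cd : VariableChange ℚ)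
    (hWd : Cd • W.quadraticTwist (NumberField.discr K : ℚ) = Wd)
    (hL : IndexLowerBoundAt W 3 K P) : BSDp W 3 := by
  haveI : Fact (Nat.Prime 3) := ⟨Nat.prime_three⟩
  have hr : W.analyticRank = 1 := hX.1
  have hmult : W.HasMultiplicativeReductionAtPrime 3 := hX.2.2.1
  have hirr : Irr W 3 := hX.2.2.2
  have hsurj : Surj W 3 := surj_of_irr_of_ram W 3 hirr hram
  obtain ⟨h3d, hμ⟩ := Three.not_dvd_discr_and_not_dvd_torsionOrder_of_heegner hK hHN (p := 3) (by decide)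
    (Three.dvd_conductorNorm_of_classX11b hX)
  have hD0 : (NumberField.discr K : ℚ) ≠ 0 := by exact_mod_cast NumberField.discr_ne_zero K
  haveI hEt : (W.quadraticTwist (NumberField.discr K : ℚ)).IsElliptic := W.isElliptic_quadraticTwist hD0
  have hmultd : Wd.HasMultiplicativeReductionAtPrime 3 :=
    hasMultiplicativeReductionAtPrime_twist_of_heegner' W 3 K hK hHN hmult Cd hWd
  have hirrd : Wd.HasIrreducibleModPGaloisRep 3 := hasIrreducibleModPGaloisRep_twist_model W 3 K hK.1 hirr Cd hWd
  have hramd : Ram Wd 3 := ram_twist_of_heegner W 3 K hK hHN hram Cd hWd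
  have htam : padicValNat 3 Wd.tamagawaProduct = padicValNat 3 W.tamagawaProduct :=
    O5.TwistTamagawa.padicValNat_tamagawaProduct_twist_of_heegner_three W Wd K hK hHN h3d Cd hWd
  have hu : padicValRat 3 (Cd.u : ℚ) = 0 := padicValRat_u_eq_zero_of_twist_minimal W 3 K hK hHN hmult Cd hWd
  have hLt' : (W.quadraticTwist (NumberField.discr K : ℚ)).entireLFunction = Wd.entireLFunction := by
    rw [← hWd, entireLFunction_smul]
  have hLd1 : Wd.entireLFunction 1 ≠ 0 := by rw [← hLt']; exact hLt
  have hrd : Wd.analyticRank = 0 := (Wd.analyticRank_eq_zero_iff_holds (hmod Wd)).2 hLd1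
  have hfinSd : Finite Wd.sha := (hGZK Wd (by omega)).2
  obtain ⟨qd, hqd, hvqd⟩ := hSk Wd 3 le_rfl (Or.inr hmultd) hirrd hramd hLd1 hfinSd
  have h1 : Typed.MissingLowerBoundAt W 3 :=
    missingLowerBoundAt_of_indexLowerBoundAt W 3 (W.conductorNorm ℤ) K Dt H ι P hGZ hKo hGZK hmod hK hHN hP
      (by decide) (by exact_mod_cast hc) hμ hr hLt Wd Cd hWd hu htam ⟨qd, hqd, hvqd.symm.le⟩ (fun _ ↦ hL)
  have h2 : Typed.MissingUpperBoundAt W 3 :=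
    missingUpperBoundAt_of_shaIndexBound W 3 (W.conductorNorm ℤ) K Dt H ι P hGZ hKo hGZK hmod hK hHN hP
      (by decide) (by exact_mod_cast hc) hμ hr hLt Wd Cd hWd hu htam htam0 ⟨qd, hqd, hvqd.le⟩
      (fun _ hnt ↦ hB hK hHN ⟨Dt, H, ι, hP⟩ hnt Fact.out (by decide) hsurj)
  exact bsdp_of_halves hGZK W 3 (le_of_eq hr) h1 h2

end Summit.BirchSwinnertonDyer.Rank1Residual.X11b

end
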